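import Literature.Analysis.ValidatedNumerics.ParametricVertexCertificate
import HarnessLib

/-!
# Vertex bundles for affine INTERVAL families: `|A − (A₀ + Σ p_k A^{(k)})| ≤ Δ₀ + Σ |p_k| Δ^{(k)}`

Topic `Literature/Analysis/ValidatedNumerics`. Sequel of `ParametricVertexCertificate.lean` for INEXACT
(interval) tables — the case of a client whose matrix entries come from quadrature / irrational data and are
only ENCLOSED: at parameter `p` the family is every real symmetric `A` with
`|A i j − C(p) i j| ≤ R(p) i j`, `C(p) = A₀ + Σ_k p_k A^{(k)}`, `R(p) = Δ₀ + Σ_k |p_k| Δ^{(k)}` (`Δ ≥ 0`),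
exactly the family a driver's `point(p)` hands to the `checkLower` kernel. The checker
`checkVertexBundleI` runs `checkLower` at every corner `v` on the interval data `(C(v), R(v))`; SOUNDNESS
(`le_eigenvalues_interval_affine_of_checkVertexBundleI`): for every `p` of the box and every symmetric
member `A` at `p`, `lam ≤ λᵢ(A)`.

Why vertices still decide (the one new idea beyond Hladík's Thm 7): for a fixed vector `x` the lower
ENVELOPE of the form over the family at `p`, `env(p) = xᵀC(p)x − Σᵢⱼ R(p)ᵢⱼ |xᵢ||xⱼ|`, is attained by the
member `C(p)ᵢⱼ − sᵢ sⱼ R(p)ᵢⱼ` (`sᵢ = sign xᵢ`), so the corner certificates bound `env` at the corners; and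
`env(p) = e₀ + Σ_k (p_k a_k − |p_k| c_k)` with `c_k = Σᵢⱼ Δ^{(k)}ᵢⱼ|xᵢ||xⱼ| ≥ 0` is a SEPARABLE sum of
concave functions of the single coordinates, hence bounded below on the box by its value at a corner
(`t ↦ a t − c|t|` on `[lo, hi]` is minimised at an endpoint). Nothing else is new: the per-corner bound is
`MatrixEigenEnclosure.mul_dotProduct_le_of_checkLower`, the eigenvalue packaging is
`ParametricEigenMargin.le_eigenvalues_of_forall_form_real`.

## What is NOT certified

Radii tables must be entrywise `≥ 0` (checked); non-affine dependence; anything off the box; which member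
of the family a client's true matrix is (that is the client's enclosure claim).

## References

* [Hladik2017] M. Hladík, arXiv:1704.05782 (2017), Thm. 7 (vertex property of linear parametric
  families) and §3 (parametric INTERVAL matrices `A(p)` with interval coefficients); the envelope /
  separable-concavity step is the standard interval-arithmetic reading of §3. [cite: Hladik2017, Thm. 7 and §3]
-/

open Finset Matrix

namespace Literature.Analysis.ValidatedNumerics

open ParametricIntervalPosSemidef ParametricEigenMargin

/-! ### Data and checker -/

/-- The radii at a corner: `R(v) = Δ₀ + Σ_{k<K} |v_k| Δ^{(k)}` as a rational table.
[cite: Hladik2017, §3 (parametric interval matrix)] -/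
def affineRadAtQ (n K : ℕ) (D0 : List (List ℚ)) (Ds : List (List (List ℚ))) (v : List ℚ) :
    List (List ℚ) :=
  mtab n n fun i j ↦ mget D0 i j + rsum K fun k ↦ |vget v k| * mget (Ds.getD k []) i j

/-- Entrywise non-negativity of a rational table on the `n × n` block. [folklore] -/
def nonnegQ (n : ℕ) (A : List (List ℚ)) : Bool :=
  rall n fun i ↦ rall n fun j ↦ decide (0 ≤ mget A i j)

/-- **The interval vertex-bundle checker**: centre tables symmetric, radii tables non-negative, and at
every corner `v` a `checkLower` certificate with claim `≥ lam` for the interval data `(C(v), R(v))`.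
[cite: Hladik2017, Thm. 7 and §3] -/
def checkVertexBundleI (n K : ℕ) (A0 : List (List ℚ)) (As : List (List (List ℚ))) (D0 : List (List ℚ))
    (Ds : List (List (List ℚ))) (lo hi : List ℚ) (b : VertexBundle) : Bool :=
  symmQ n A0 && rall K (fun k ↦ symmQ n (As.getD k [])) && nonnegQ n D0 &&
    rall K (fun k ↦ nonnegQ n (Ds.getD k [])) &&
    decide ((corners lo hi K).length ≤ b.certs.length) &&
    rall (corners lo hi K).length fun idx ↦
      decide (b.lam ≤ (b.certs.getD idx default).lam) &&
        checkLower n (affineAtQ n K A0 As ((corners lo hi K).getD idx []))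
          (affineRadAtQ n K D0 Ds ((corners lo hi K).getD idx [])) (b.certs.getD idx default)

/-! ### Plumbing -/

/-- Entries of `finMat` (plumbing). [folklore] -/
private theorem finMat_apply'' (n : ℕ) (A : List (List ℚ)) (i j : Fin n) :
    finMat n A i j = mreal A i j := rfl

/-- Every real corner of the box is (the cast of) a member of `corners lo hi K` (same statement as the
private lemma of `ParametricVertexCertificate.lean`). [folklore] -/
private theorem exists_mem_corners' (lo hi : List ℚ) :
    ∀ (K : ℕ) (q : ℕ → ℝ), (∀ k < K, q k = vreal lo k ∨ q k = vreal hi k) →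
      ∃ v ∈ corners lo hi K, v.length = K ∧ ∀ k < K, vreal v k = q k
  | 0, q, _ => ⟨[], by simp [corners], rfl, fun k hk ↦ absurd hk (Nat.not_lt_zero k)⟩
  | K + 1, q, hq => by
    obtain ⟨t, ht, hlen, htq⟩ := exists_mem_corners' lo hi K q fun k hk ↦ hq k (Nat.lt_succ_of_lt hk)
    have hK := hq K K.lt_succ_self
    let a : ℚ := if q K = vreal lo K then vget lo K else vget hi K
    have ha : vreal [a] 0 = q K := by
      show (((vget [a] 0 : ℚ)) : ℝ) = q K
      rw [vget_cons_zero]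
      by_cases h : q K = vreal lo K
      · simp only [a, h, ↓reduceIte]; rfl
      · simp only [a, h, ↓reduceIte]
        rcases hK with h' | h'
        · exact absurd h' h
        · exact h'.symm
    refine ⟨t ++ [a], ?_, by simp [hlen], fun k hk ↦ ?_⟩
    · simp only [corners, List.mem_flatMap, List.mem_cons, List.mem_nil_iff, or_false]
      refine ⟨t, ht, ?_⟩
      by_cases h : q K = vreal lo K
      · left; simp [a, h]
      · right; simp [a, h]
    · rcases Nat.lt_succ_iff_lt_or_eq.1 hk with hk' | hkK
      · have : vget (t ++ [a]) k = vget t k := by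
          unfold vget; exact List.getD_append _ _ _ _ (hlen ▸ hk')
        unfold vreal; rw [this]; exact htq k hk'
      · have : vget (t ++ [a]) k = vget [a] 0 := by
          unfold vget; rw [hkK, List.getD_append_right _ _ _ _ (hlen ▸ le_rfl), hlen, Nat.sub_self]
        unfold vreal at ha ⊢; rw [this, hkK]; exact ha

/-- The form as a double sum: `xᵀMx = Σᵢ Σⱼ Mᵢⱼ xᵢ xⱼ`. [folklore] -/
private theorem form_eq_sum {n : ℕ} (M : Matrix (Fin n) (Fin n) ℝ) (x : Fin n → ℝ) :
    x ⬝ᵥ M *ᵥ x = ∑ i, ∑ j, M i j * (x i * x j) := by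
  simp only [dotProduct, Matrix.mulVec, Finset.mul_sum]
  exact Finset.sum_congr rfl fun i _ ↦ Finset.sum_congr rfl fun j _ ↦ by ring

/-- `t ↦ a·t − c·|t|` with `c ≥ 0` is minimised on `[lo, hi]` at an endpoint. [folklore] -/
private theorem endpoint_le_of_mem_Icc {a c lo hi t : ℝ} (hc : 0 ≤ c) (ht : t ∈ Set.Icc lo hi) :
    min (a * lo - c * |lo|) (a * hi - c * |hi|) ≤ a * t - c * |t| := by
  rcases eq_or_lt_of_le (ht.1.trans ht.2) with hlh | hlh
  · -- degenerate interval
    have : t = lo := le_antisymm (hlh ▸ ht.2) ht.1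
    rw [this]; exact min_le_left _ _
  · -- t = θ lo + (1 − θ) hi, convexity of |·|
    set θ := (hi - t) / (hi - lo) with hθ
    have hd : 0 < hi - lo := sub_pos.2 hlh
    have hθ0 : 0 ≤ θ := div_nonneg (sub_nonneg.2 ht.2) hd.le
    have hθ1 : θ ≤ 1 := (div_le_one hd).2 (by linarith [ht.1])
    have ht' : t = θ * lo + (1 - θ) * hi := by
      rw [hθ]; field_simp; ring
    have hθ1' : (0 : ℝ) ≤ 1 - θ := sub_nonneg.2 hθ1
    have habs : |t| ≤ θ * |lo| + (1 - θ) * |hi| := by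
      rw [ht']
      calc |θ * lo + (1 - θ) * hi| ≤ |θ * lo| + |(1 - θ) * hi| := abs_add_le _ _
        _ = θ * |lo| + (1 - θ) * |hi| := by
          rw [abs_mul, abs_mul, abs_of_nonneg hθ0, abs_of_nonneg hθ1']
    have key : θ * (a * lo - c * |lo|) + (1 - θ) * (a * hi - c * |hi|) ≤ a * t - c * |t| := by
      rw [ht'] at habs ⊢
      nlinarith [mul_le_mul_of_nonneg_left habs hc]
    rcases le_total (a * lo - c * |lo|) (a * hi - c * |hi|) with h | h
    · rw [min_eq_left h]; nlinarith
    · rw [min_eq_right h]; nlinarith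

/-! ### The real objects -/

/-- The centre family `C(p) = A₀ + Σ p_k A^{(k)}` (abbreviation). [cite: Hladik2017, §2] -/
private def cen (n K : ℕ) (A0 : List (List ℚ)) (As : List (List (List ℚ))) (p : Fin K → ℝ) :
    Matrix (Fin n) (Fin n) ℝ :=
  finMat n A0 + paramMatrix (fun k : Fin K ↦ finMat n (As.getD k [])) p

/-- The radii `R(p) i j = Δ₀ i j + Σ |p_k| Δ^{(k)} i j`. [cite: Hladik2017, §3] -/
private def rad (n K : ℕ) (D0 : List (List ℚ)) (Ds : List (List (List ℚ))) (p : Fin K → ℝ) (i j : Fin n) : ℝ :=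
  mreal D0 i j + ∑ k : Fin K, |p k| * mreal (Ds.getD k []) i j

/-- The lower envelope of the form over the family at `p`, for a fixed `x`. [cite: Hladik2017, §3] -/
private def env (n K : ℕ) (A0 : List (List ℚ)) (As : List (List (List ℚ))) (D0 : List (List ℚ))
    (Ds : List (List (List ℚ))) (x : Fin n → ℝ) (p : Fin K → ℝ) : ℝ :=
  x ⬝ᵥ cen n K A0 As p *ᵥ x - ∑ i : Fin n, ∑ j : Fin n, rad n K D0 Ds p i j * (|x i| * |x j|)

/-- The separable coefficients: `a_k = xᵀA^{(k)}x`, `c_k = Σ Δ^{(k)}ᵢⱼ |xᵢ||xⱼ|`, and the constant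
`e₀ = xᵀA₀x − Σ Δ₀ᵢⱼ|xᵢ||xⱼ|`; `env(p) = e₀ + Σ_k (p_k a_k − |p_k| c_k)`. [cite: Hladik2017, §3] -/
private theorem env_eq_separable {n K : ℕ} (A0 : List (List ℚ)) (As : List (List (List ℚ)))
    (D0 : List (List ℚ)) (Ds : List (List (List ℚ))) (x : Fin n → ℝ) (p : Fin K → ℝ) :
    env n K A0 As D0 Ds x p
      = (x ⬝ᵥ finMat n A0 *ᵥ x - ∑ i : Fin n, ∑ j : Fin n, mreal D0 i j * (|x i| * |x j|))
        + ∑ k : Fin K, (p k * (x ⬝ᵥ finMat n (As.getD k []) *ᵥ x)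
          - |p k| * ∑ i : Fin n, ∑ j : Fin n, mreal (Ds.getD k []) i j * (|x i| * |x j|)) := by
  unfold env cen rad
  rw [Matrix.add_mulVec, dotProduct_add, form_paramMatrix]
  have hsplit : (∑ i : Fin n, ∑ j : Fin n,
        (mreal D0 i j + ∑ k : Fin K, |p k| * mreal (Ds.getD k []) i j) * (|x i| * |x j|))
      = (∑ i : Fin n, ∑ j : Fin n, mreal D0 i j * (|x i| * |x j|))
        + ∑ k : Fin K, |p k| * ∑ i : Fin n, ∑ j : Fin n, mreal (Ds.getD k []) i j * (|x i| * |x j|) := by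
    have h1 : ∀ i j : Fin n,
        (mreal D0 i j + ∑ k : Fin K, |p k| * mreal (Ds.getD k []) i j) * (|x i| * |x j|)
          = mreal D0 i j * (|x i| * |x j|)
            + ∑ k : Fin K, |p k| * (mreal (Ds.getD k []) i j * (|x i| * |x j|)) := by
      intro i j
      rw [add_mul, Finset.sum_mul]
      exact congrArg _ (Finset.sum_congr rfl fun k _ ↦ by ring)
    have h2 : ∀ i : Fin n, ∑ j : Fin n, ∑ k : Fin K, |p k| * (mreal (Ds.getD k []) i j * (|x i| * |x j|))
        = ∑ k : Fin K, ∑ j : Fin n, |p k| * (mreal (Ds.getD k []) i j * (|x i| * |x j|)) :=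
      fun i ↦ Finset.sum_comm
    simp only [h1, Finset.sum_add_distrib, h2]
    congr 1
    rw [Finset.sum_comm]
    refine Finset.sum_congr rfl fun k _ ↦ ?_
    rw [Finset.mul_sum]
    refine Finset.sum_congr rfl fun i _ ↦ ?_
    rw [Finset.mul_sum]
  rw [hsplit, Finset.sum_sub_distrib]
  ring

/-- **Member bound**: every member `A` of the family at `p` satisfies `xᵀAx ≥ env(p)`. [cite: Hladik2017, §3] -/
private theorem env_le_form {n K : ℕ} {A0 : List (List ℚ)} {As : List (List (List ℚ))}
    {D0 : List (List ℚ)} {Ds : List (List (List ℚ))} {p : Fin K → ℝ} {A : Matrix (Fin n) (Fin n) ℝ}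
    (hmem : ∀ i j : Fin n, |A i j - cen n K A0 As p i j| ≤ rad n K D0 Ds p i j) (x : Fin n → ℝ) :
    env n K A0 As D0 Ds x p ≤ x ⬝ᵥ A *ᵥ x := by
  unfold env
  rw [form_eq_sum, form_eq_sum, ← Finset.sum_sub_distrib]
  refine Finset.sum_le_sum fun i _ ↦ ?_
  rw [← Finset.sum_sub_distrib]
  refine Finset.sum_le_sum fun j _ ↦ ?_
  have h1 : |(A i j - cen n K A0 As p i j) * (x i * x j)| ≤ rad n K D0 Ds p i j * (|x i| * |x j|) := by
    rw [abs_mul, abs_mul]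
    exact mul_le_mul_of_nonneg_right (hmem i j) (mul_nonneg (abs_nonneg _) (abs_nonneg _))
  have h2 := neg_abs_le ((A i j - cen n K A0 As p i j) * (x i * x j))
  nlinarith

/-- The radii table at a cast corner equals (the cast of) `affineRadAtQ`. [folklore] -/
private theorem rad_eq_mreal_affineRadAtQ {n K : ℕ} (D0 : List (List ℚ)) (Ds : List (List (List ℚ)))
    {q : Fin K → ℝ} {v : List ℚ} (hv : ∀ k : Fin K, vreal v k = q k) (i j : Fin n) :
    rad n K D0 Ds q i j = mreal (affineRadAtQ n K D0 Ds v) i j := by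
  unfold rad affineRadAtQ mreal
  rw [mget_mtab _ i.isLt j.isLt, rsum_eq_sum]
  push_cast
  rw [← Fin.sum_univ_eq_sum_range (fun k ↦ |((vget v k : ℚ) : ℝ)| * ((mget (Ds.getD k []) i j : ℚ) : ℝ)) K]
  congr 1
  refine Finset.sum_congr rfl fun k _ ↦ ?_
  rw [← hv k]; rfl

/-- The centre family at a cast corner equals (the cast of) `affineAtQ`. [folklore] -/
private theorem cen_eq_mreal_affineAtQ {n K : ℕ} (A0 : List (List ℚ)) (As : List (List (List ℚ)))
    {q : Fin K → ℝ} {v : List ℚ} (hv : ∀ k : Fin K, vreal v k = q k) (i j : Fin n) :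
    cen n K A0 As q i j = mreal (affineAtQ n K A0 As v) i j := by
  unfold cen
  rw [Matrix.add_apply, paramMatrix_apply, finMat_apply'']
  unfold affineAtQ mreal
  rw [mget_mtab _ i.isLt j.isLt, rsum_eq_sum]
  push_cast
  rw [← Fin.sum_univ_eq_sum_range (fun k ↦ ((vget v k : ℚ) : ℝ) * ((mget (As.getD k []) i j : ℚ) : ℝ)) K]
  congr 1
  refine Finset.sum_congr rfl fun k _ ↦ ?_
  rw [finMat_apply'']; unfold mreal
  rw [← hv k]; rfl

/-- Radii non-negativity at a real point from the table checks. [folklore] -/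
private theorem rad_nonneg {n K : ℕ} {D0 : List (List ℚ)} {Ds : List (List (List ℚ))}
    (h0 : nonnegQ n D0 = true) (hs : rall K (fun k ↦ nonnegQ n (Ds.getD k [])) = true) (p : Fin K → ℝ)
    (i j : Fin n) : 0 ≤ rad n K D0 Ds p i j := by
  unfold rad
  have e0 : (0 : ℝ) ≤ mreal D0 i j := by
    have := of_rall (of_rall h0 i.isLt) j.isLt; rw [decide_eq_true_eq] at this
    unfold mreal; exact_mod_cast this
  refine add_nonneg e0 (Finset.sum_nonneg fun k _ ↦ mul_nonneg (abs_nonneg _) ?_)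
  have := of_rall (of_rall (of_rall hs k.isLt) i.isLt) j.isLt; rw [decide_eq_true_eq] at this
  unfold mreal; exact_mod_cast this

/-- **Corner bound**: at a real corner `q` the envelope is `≥ lam · xᵀx` (apply the corner certificate to
the sign member `C(q)ᵢⱼ − sᵢsⱼR(q)ᵢⱼ`). [cite: Hladik2017, Thm. 7 (vertex facts), §3] -/
private theorem env_ge_at_corner {n K : ℕ} {A0 : List (List ℚ)} {As : List (List (List ℚ))}
    {D0 : List (List ℚ)} {Ds : List (List (List ℚ))} {lo hi : List ℚ} {b : VertexBundle}
    (h : checkVertexBundleI n K A0 As D0 Ds lo hi b = true) {q : Fin K → ℝ}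
    (hq : IsBoxVertex (fun k : Fin K ↦ vreal lo k) (fun k : Fin K ↦ vreal hi k) q) (x : Fin n → ℝ) :
    (b.lam : ℝ) * (x ⬝ᵥ x) ≤ env n K A0 As D0 Ds x q := by
  unfold checkVertexBundleI at h
  simp only [Bool.and_eq_true, decide_eq_true_eq] at h
  obtain ⟨⟨⟨⟨⟨-, -⟩, h0⟩, hs⟩, hlen⟩, hall⟩ := h
  let qN : ℕ → ℝ := fun k ↦ if hk : k < K then q ⟨k, hk⟩ else 0
  have hqN : ∀ k < K, qN k = vreal lo k ∨ qN k = vreal hi k := fun k hk ↦ by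
    simp only [qN, hk, ↓reduceDIte]; exact hq ⟨k, hk⟩
  obtain ⟨v, hvmem, -, hvq⟩ := exists_mem_corners' lo hi K qN hqN
  have hv : ∀ k : Fin K, vreal v k = q k := fun k ↦ by
    rw [hvq k k.isLt]; simp only [qN, k.isLt, ↓reduceDIte]
  obtain ⟨idx, hidx, hget⟩ := List.getElem_of_mem hvmem
  have hgetD : (corners lo hi K).getD idx [] = v := by
    rw [List.getD_eq_getElem (l := corners lo hi K) (d := []) hidx, hget]
  have h1 := of_rall hall hidx
  rw [Bool.and_eq_true, decide_eq_true_eq, hgetD] at h1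
  obtain ⟨hlam, hcheck⟩ := h1
  -- the sign member
  let s : Fin n → ℝ := fun i ↦ if 0 ≤ x i then 1 else -1
  have hsx : ∀ i, s i * x i = |x i| := fun i ↦ by
    by_cases hx : 0 ≤ x i
    · simp only [s, hx, ↓reduceIte, one_mul, abs_of_nonneg hx]
    · simp only [s, hx, ↓reduceIte]; rw [abs_of_neg (lt_of_not_ge hx)]; ring
  have hsabs : ∀ i, |s i| = 1 := fun i ↦ by
    by_cases hx : 0 ≤ x i <;> simp [s, hx]
  let Astar : Matrix (Fin n) (Fin n) ℝ := fun i j ↦ cen n K A0 As q i j - s i * s j * rad n K D0 Ds q i j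
  have hΔ : ∀ i j : Fin n, |Astar i j - mreal (affineAtQ n K A0 As v) i j|
      ≤ mreal (affineRadAtQ n K D0 Ds v) i j := fun i j ↦ by
    show |cen n K A0 As q i j - s i * s j * rad n K D0 Ds q i j - mreal (affineAtQ n K A0 As v) i j| ≤ _
    rw [← cen_eq_mreal_affineAtQ A0 As hv, ← rad_eq_mreal_affineRadAtQ D0 Ds hv, sub_sub_cancel_left,
      abs_neg, abs_mul, abs_mul, hsabs, hsabs, one_mul, one_mul, abs_of_nonneg (rad_nonneg h0 hs q i j)]
  have h2 := mul_dotProduct_le_of_checkLower hcheck hΔ x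
  have hform : x ⬝ᵥ Astar *ᵥ x = env n K A0 As D0 Ds x q := by
    unfold env
    rw [form_eq_sum, form_eq_sum, ← Finset.sum_sub_distrib]
    refine Finset.sum_congr rfl fun i _ ↦ ?_
    rw [← Finset.sum_sub_distrib]
    refine Finset.sum_congr rfl fun j _ ↦ ?_
    show (cen n K A0 As q i j - s i * s j * rad n K D0 Ds q i j) * (x i * x j) = _
    rw [← hsx i, ← hsx j]; ring
  have hxx : 0 ≤ x ⬝ᵥ x := Finset.sum_nonneg fun i _ ↦ mul_self_nonneg (x i)
  calc (b.lam : ℝ) * (x ⬝ᵥ x) ≤ ((b.certs.getD idx default).lam : ℝ) * (x ⬝ᵥ x) :=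
        mul_le_mul_of_nonneg_right (by exact_mod_cast hlam) hxx
    _ ≤ x ⬝ᵥ Astar *ᵥ x := h2
    _ = env n K A0 As D0 Ds x q := hform

/-- **Box bound**: the envelope at any `p` of the box dominates the envelope at SOME corner (separable
concavity), hence is `≥ lam · xᵀx`. [cite: Hladik2017, Thm. 7 and §3] -/
private theorem env_ge_on_box {n K : ℕ} {A0 : List (List ℚ)} {As : List (List (List ℚ))}
    {D0 : List (List ℚ)} {Ds : List (List (List ℚ))} {lo hi : List ℚ} {b : VertexBundle}
    (h : checkVertexBundleI n K A0 As D0 Ds lo hi b = true) {p : Fin K → ℝ}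
    (hp : p ∈ Set.Icc (fun k : Fin K ↦ vreal lo k) (fun k : Fin K ↦ vreal hi k)) (x : Fin n → ℝ) :
    (b.lam : ℝ) * (x ⬝ᵥ x) ≤ env n K A0 As D0 Ds x p := by
  -- per-coordinate coefficients and the minimising corner
  let a : Fin K → ℝ := fun k ↦ x ⬝ᵥ finMat n (As.getD k []) *ᵥ x
  let c : Fin K → ℝ := fun k ↦ ∑ i : Fin n, ∑ j : Fin n, mreal (Ds.getD k []) i j * (|x i| * |x j|)
  let q : Fin K → ℝ := fun k ↦
    if a k * vreal lo k - c k * |vreal lo k| ≤ a k * vreal hi k - c k * |vreal hi k| then vreal lo k else vreal hi k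
  have hq : IsBoxVertex (fun k : Fin K ↦ vreal lo k) (fun k : Fin K ↦ vreal hi k) q := fun k ↦ by
    by_cases hk : a k * vreal lo k - c k * |vreal lo k| ≤ a k * vreal hi k - c k * |vreal hi k|
    · left; simp only [q, hk, ↓reduceIte]
    · right; simp only [q, hk, ↓reduceIte]
  have hc : ∀ k, 0 ≤ c k := by
    intro k
    unfold checkVertexBundleI at h
    simp only [Bool.and_eq_true, decide_eq_true_eq] at h
    have hs := h.1.1.2
    refine Finset.sum_nonneg fun i _ ↦ Finset.sum_nonneg fun j _ ↦ mul_nonneg ?_ (mul_nonneg (abs_nonneg _) (abs_nonneg _))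
    have := of_rall (of_rall (of_rall hs k.isLt) i.isLt) j.isLt; rw [decide_eq_true_eq] at this
    unfold mreal; exact_mod_cast this
  have hterm : ∀ k, a k * q k - c k * |q k| ≤ a k * p k - c k * |p k| := by
    intro k
    have hmin := endpoint_le_of_mem_Icc (a := a k) (hc k) (show p k ∈ Set.Icc (vreal lo k) (vreal hi k) from ⟨hp.1 k, hp.2 k⟩)
    by_cases hk : a k * vreal lo k - c k * |vreal lo k| ≤ a k * vreal hi k - c k * |vreal hi k|
    · simp only [q, hk, ↓reduceIte]; rw [min_eq_left hk] at hmin; exact hmin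
    · simp only [q, hk, ↓reduceIte]; rw [min_eq_right (le_of_not_ge hk)] at hmin; exact hmin
  have henv : env n K A0 As D0 Ds x q ≤ env n K A0 As D0 Ds x p := by
    rw [env_eq_separable, env_eq_separable]
    refine add_le_add le_rfl (Finset.sum_le_sum fun k _ ↦ ?_)
    have := hterm k
    simp only [a, c] at this
    linarith
  exact (env_ge_at_corner h hq x).trans henv

/-! ### Soundness -/

/-- `A₀` is symmetric when the interval bundle checks. [cite: Hladik2017, §2 (symmetric tables)] -/
theorem isHermitian_A0_of_checkVertexBundleI {n K : ℕ} {A0 : List (List ℚ)} {As : List (List (List ℚ))}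
    {D0 : List (List ℚ)} {Ds : List (List (List ℚ))} {lo hi : List ℚ} {b : VertexBundle}
    (h : checkVertexBundleI n K A0 As D0 Ds lo hi b = true) : (finMat n A0).IsHermitian := by
  unfold checkVertexBundleI at h
  simp only [Bool.and_eq_true, decide_eq_true_eq] at h
  refine Matrix.IsHermitian.ext fun i j ↦ ?_
  have h1 := of_rall (of_rall h.1.1.1.1.1 j.isLt) i.isLt
  rw [decide_eq_true_eq] at h1
  rw [star_trivial, finMat_apply'', finMat_apply'']
  unfold mreal; rw [h1]

/-- **Eigenvalue margin for an affine INTERVAL family over a box from a kernel-checked interval vertex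
bundle (END-TO-END).** If `checkVertexBundleI n K A0 As D0 Ds lo hi b = true` then for every `p` of the
box and every real symmetric `A` with `|A i j − (A₀ + Σ p_k A^{(k)}) i j| ≤ Δ₀ i j + Σ |p_k| Δ^{(k)} i j`:
`b.lam ≤ λᵢ(A)` for every `i`. [cite: Hladik2017, Thm. 7 and §3] -/
theorem le_eigenvalues_interval_affine_of_checkVertexBundleI {n K : ℕ} {A0 : List (List ℚ)}
    {As : List (List (List ℚ))} {D0 : List (List ℚ)} {Ds : List (List (List ℚ))} {lo hi : List ℚ}
    {b : VertexBundle} (h : checkVertexBundleI n K A0 As D0 Ds lo hi b = true) {p : Fin K → ℝ}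
    (hp : p ∈ Set.Icc (fun k : Fin K ↦ vreal lo k) (fun k : Fin K ↦ vreal hi k))
    {A : Matrix (Fin n) (Fin n) ℝ} (hA : A.IsHermitian)
    (hmem : ∀ i j : Fin n, |A i j - (finMat n A0 + paramMatrix (fun k : Fin K ↦ finMat n (As.getD k [])) p) i j|
      ≤ mreal D0 i j + ∑ k : Fin K, |p k| * mreal (Ds.getD k []) i j) (i : Fin n) :
    (b.lam : ℝ) ≤ hA.eigenvalues i :=
  le_eigenvalues_of_forall_form_real hA (fun x ↦ (env_ge_on_box h hp x).trans (env_le_form hmem x)) i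

/-- Form version (no symmetry of `A` needed): `lam · xᵀx ≤ xᵀAx` for every member at every `p` of the
box. [cite: Hladik2017, Thm. 7 and §3] -/
theorem form_ge_interval_affine_of_checkVertexBundleI {n K : ℕ} {A0 : List (List ℚ)}
    {As : List (List (List ℚ))} {D0 : List (List ℚ)} {Ds : List (List (List ℚ))} {lo hi : List ℚ}
    {b : VertexBundle} (h : checkVertexBundleI n K A0 As D0 Ds lo hi b = true) {p : Fin K → ℝ}
    (hp : p ∈ Set.Icc (fun k : Fin K ↦ vreal lo k) (fun k : Fin K ↦ vreal hi k))
    {A : Matrix (Fin n) (Fin n) ℝ}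
    (hmem : ∀ i j : Fin n, |A i j - (finMat n A0 + paramMatrix (fun k : Fin K ↦ finMat n (As.getD k [])) p) i j|
      ≤ mreal D0 i j + ∑ k : Fin K, |p k| * mreal (Ds.getD k []) i j) (x : Fin n → ℝ) :
    (b.lam : ℝ) * (x ⬝ᵥ x) ≤ x ⬝ᵥ A *ᵥ x :=
  (env_ge_on_box h hp x).trans (env_le_form hmem x)

/-! ### Kernel example -/

/-- `A(p) = [[2, p], [p, 2]] ± 1/10` entrywise (radii constant, `Δ^{(1)} = 0`) on `p ∈ [−1, 1]`: the
corner interval families `[[2, ∓1], [∓1, 2]] ± 1/10` pass the Gershgorin form with `lam = 4/5`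
(`|off| + radii row sum 1/5 ≤ 2 − 4/5`), so every symmetric member at every `p` has `λᵢ ≥ 4/5`. -/
example : checkVertexBundleI 2 1 [[2, 0], [0, 2]] [[[0, 1], [1, 0]]] [[1/10, 1/10], [1/10, 1/10]]
    [[[0, 0], [0, 0]]] [-1] [1] ⟨4/5, [⟨4/5, 0, [], []⟩, ⟨4/5, 0, [], []⟩]⟩ = true := by
  decide +kernel

end Literature.Analysis.ValidatedNumerics
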